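import Mathlib

/-!
# Small sumset cover for non-resonant 2×2 cancellations (supports `stub_swallowedInSmallSumset`,
crux `MomentCurveElusive`, item stmt-ValiantsHypothesis-6534, route GirthSidon, line `registered`)

Setting (crux directory, LEAD-ANALYSIS-c5.md §0–1): sources `y_j = t^{o_j} u_j`; a born target initiated
by a 2×2 cancellation at the balanced weight `o_a + o_b = o_c + o_d` has exponent
`D = o_a + o_b + γ`, `γ = ord(u_a u_b − u_c u_d)`.  Since
`u_a u_b − u_c u_d = u_b (u_a − u_c) + u_c (u_b − u_d) = u_b (u_a − u_d) + u_d (u_b − u_c)`,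
the depth satisfies `γ ≥ max(min(δ(a,c), δ(b,d)), min(δ(a,d), δ(b,c)))` for the `t`-adic ULTRAMETRIC
`δ(x,z) = ord(u_x − u_z)` on the sources, with equality unless the two leading differences cancel
("resonance").  In the NON-RESONANT case the depth is therefore WITNESSED BY A CROSS COUPLE:
`γ = δ(α, β)` for some `α ∈ {a,b}`, `β ∈ {c,d}` — after relabelling inside the two pairs, `γ = ord(u_a − u_c)`.

Main result (`exists_small_cover_of_crossDepth`): if every target `i < m` has
`D_i = o_{a_i} + o_{b_i} + γ_i`, balanced weight `o_{a_i} + o_{b_i} = o_{c_i} + o_{d_i}`, and a cross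
witness `ord(u_{a_i} − u_{c_i}) = γ_i`, then `D ⊆ U + U` for a set `U ⊂ ℕ` with
`|U| ≤ n · (log₂ n + 1)` — the conclusion of `stub_swallowedInSmallSumset` (cover form) for this
class, with a cover that is toric up to a logarithm.  NO hypothesis on the `u_j` is needed (any power
series), and the number of targets `m` is arbitrary.

Proof = heavy–light attribution on the ultrametric: the balls `B_g(x) = {z : δ(x,z) ≥ g}` are nested in
`g`; if `δ(x,z) = g` then `B_g(x) = B_g(z)` and the two smaller balls `B_{g+1}(x)`, `B_{g+1}(z)` are
disjoint inside it, so one of them has at most half the size ("`g` is light for `x`" or for `z`); along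
the chain of balls of a fixed `x` at most `log₂ n` radii are light (`two_pow_card_light_le`).  Put
`U = O ∪ {o_x + g : g light for x}`; a target with witness couple `(a,c)` is `(o_a + γ) + o_b` if `γ` is
light for `a`, and `(o_c + γ) + o_d` (balanced weight!) if `γ` is light for `c`.

What is NOT covered: resonant depths (`γ` strictly larger than both matching minima), i.e. exactly the
2×2 cancellations whose two leading differences cancel against each other; by LEAD-ANALYSIS-c5 §1 these
need additive coincidences among sibling positions in the graded pieces of the unit-norm flag.
-/

-- (Sub = Summit), so the duplicated namespace component is intended.
set_option linter.dupNamespace false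

namespace Summit.ValiantsHypothesis.ValiantsHypothesis.Theorems

open PowerSeries Finset

section Ultrametric

variable {R : Type*} [CommRing R]

/-- **Strong triangle inequality for the `t`-adic distance** `δ(p,r) = ord(p − r)` on power series:
`min(ord(p − q), ord(q − r)) ≤ ord(p − r)`. [folklore] -/
theorem min_order_sub_le_order_sub (p q r : R⟦X⟧) :
    min ((p - q).order) ((q - r).order) ≤ (p - r).order := by
  have h : p - r = (p - q) + (q - r) := by ring
  rw [h]
  exact min_order_le_order_add _ _

/-- The `t`-adic distance is symmetric: `ord(p − q) = ord(q − p)`. [folklore] -/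
theorem order_sub_comm (p q : R⟦X⟧) : (p - q).order = (q - p).order := by
  rw [← order_neg, neg_sub]

variable {n : ℕ} (u : Fin n → R⟦X⟧)

/-- **Equal balls.** If `δ(x,z) ≥ g` then the closed balls of radius `g` about `x` and about `z`
coincide: `{y : ord(u_x − u_y) ≥ g} = {y : ord(u_z − u_y) ≥ g}`. [folklore] -/
theorem ball_eq_of_le (x z : Fin n) (g : ℕ∞) (hxz : g ≤ (u x - u z).order) :
    (univ.filter fun y => g ≤ (u x - u y).order) = (univ.filter fun y => g ≤ (u z - u y).order) := by
  ext y
  simp only [mem_filter, mem_univ, true_and]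
  constructor
  · intro hy
    have h := min_order_sub_le_order_sub (u z) (u x) (u y)
    rw [order_sub_comm (u z) (u x)] at h
    exact le_trans (le_min hxz hy) h
  · intro hy
    exact le_trans (le_min hxz hy) (min_order_sub_le_order_sub (u x) (u z) (u y))

/-- **Disjoint smaller balls.** If `δ(x,z) = g` is finite then the balls of radius `g+1` about `x`
and about `z` are disjoint. [folklore] -/
theorem disjoint_balls_succ (x z : Fin n) (g : ℕ) (hxz : (u x - u z).order = g) :
    Disjoint (univ.filter fun y => ((g + 1 : ℕ) : ℕ∞) ≤ (u x - u y).order)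
      (univ.filter fun y => ((g + 1 : ℕ) : ℕ∞) ≤ (u z - u y).order) := by
  rw [Finset.disjoint_filter]
  intro y _ hxy hzy
  have h := min_order_sub_le_order_sub (u x) (u y) (u z)
  rw [order_sub_comm (u y) (u z), hxz] at h
  have h' : ((g + 1 : ℕ) : ℕ∞) ≤ (g : ℕ∞) := le_trans (le_min hxy hzy) h
  have h'' : g + 1 ≤ g := by exact_mod_cast h'
  omega

/-- **Light for one of the two.** If `δ(x,z) = g` is finite then the radius `g` is LIGHT for `x` or
for `z`: the ball of radius `g+1` about it has at most half the size of the (common) ball of radius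
`g`. [folklore] -/
theorem light_or_light (x z : Fin n) (g : ℕ) (hxz : (u x - u z).order = g) :
    2 * (univ.filter fun y => ((g + 1 : ℕ) : ℕ∞) ≤ (u x - u y).order).card ≤
        (univ.filter fun y => (g : ℕ∞) ≤ (u x - u y).order).card ∨
      2 * (univ.filter fun y => ((g + 1 : ℕ) : ℕ∞) ≤ (u z - u y).order).card ≤
        (univ.filter fun y => (g : ℕ∞) ≤ (u z - u y).order).card := by
  -- the two big balls coincide
  have hbig : (univ.filter fun y => (g : ℕ∞) ≤ (u x - u y).order) =
      (univ.filter fun y => (g : ℕ∞) ≤ (u z - u y).order) :=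
    ball_eq_of_le u x z g (by rw [hxz])
  -- the two small balls are disjoint subsets of the big one
  have hsub : (univ.filter fun y => ((g + 1 : ℕ) : ℕ∞) ≤ (u x - u y).order) ∪
      (univ.filter fun y => ((g + 1 : ℕ) : ℕ∞) ≤ (u z - u y).order) ⊆
      (univ.filter fun y => (g : ℕ∞) ≤ (u x - u y).order) := by
    intro y hy
    rw [mem_union] at hy
    simp only [mem_filter, mem_univ, true_and] at hy ⊢
    have hg : (g : ℕ∞) ≤ ((g + 1 : ℕ) : ℕ∞) := by exact_mod_cast Nat.le_succ g
    rcases hy with hy | hy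
    · exact le_trans hg hy
    · have : (g : ℕ∞) ≤ (u z - u y).order := le_trans hg hy
      have hmem : y ∈ (univ.filter fun y => (g : ℕ∞) ≤ (u z - u y).order) := by simp [this]
      rw [← hbig] at hmem
      simpa using hmem
  have hcard := card_le_card hsub
  rw [card_union_of_disjoint (disjoint_balls_succ u x z g hxz)] at hcard
  rw [← hbig]
  omega

/-- **At most `log₂ n` light radii per point.** For a fixed `x`, the ball sizes
`f(g) = |{y : ord(u_x − u_y) ≥ g}|` are antitone in `g`, start at `f(0) = n` and stay `≥ 1` (they contain
`x`); every light radius halves the size, so `2^{#light radii below G} ≤ n`. [folklore] -/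
theorem two_pow_card_light_le (x : Fin n) (G : ℕ) :
    2 ^ ((range G).filter fun g => 2 * (univ.filter fun y => ((g + 1 : ℕ) : ℕ∞) ≤ (u x - u y).order).card
        ≤ (univ.filter fun y => (g : ℕ∞) ≤ (u x - u y).order).card).card ≤ n := by
  -- ball sizes
  set f : ℕ → ℕ := fun g => (univ.filter fun y => (g : ℕ∞) ≤ (u x - u y).order).card with hf
  have hanti : ∀ g, f (g + 1) ≤ f g := by
    intro g
    apply card_le_card
    intro y hy
    simp only [mem_filter, mem_univ, true_and] at hy ⊢
    exact le_trans (by exact_mod_cast Nat.le_succ g) hy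
  have hf0 : f 0 = n := by
    simp [hf]
  have hfpos : ∀ g, 1 ≤ f g := by
    intro g
    rw [hf]
    apply Nat.succ_le_of_lt
    apply card_pos.2
    exact ⟨x, by simp⟩
  -- the invariant `2^{#light < G} * f G ≤ f 0`
  have key : ∀ G, 2 ^ ((range G).filter fun g => 2 * f (g + 1) ≤ f g).card * f G ≤ f 0 := by
    intro G
    induction G with
    | zero => simp
    | succ G ih =>
        rw [range_add_one, filter_insert]
        by_cases hl : 2 * f (G + 1) ≤ f G
        · rw [if_pos hl, card_insert_of_notMem (by simp), pow_succ]
          calc 2 ^ ((range G).filter fun g => 2 * f (g + 1) ≤ f g).card * 2 * f (G + 1)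
              = 2 ^ ((range G).filter fun g => 2 * f (g + 1) ≤ f g).card * (2 * f (G + 1)) := by ring
            _ ≤ 2 ^ ((range G).filter fun g => 2 * f (g + 1) ≤ f g).card * f G :=
                Nat.mul_le_mul_left _ hl
            _ ≤ f 0 := ih
        · rw [if_neg hl]
          exact le_trans (Nat.mul_le_mul_left _ (hanti G)) ih
  have h := key G
  rw [hf0] at h
  calc 2 ^ ((range G).filter fun g => 2 * f (g + 1) ≤ f g).card
      ≤ 2 ^ ((range G).filter fun g => 2 * f (g + 1) ≤ f g).card * f G :=
        Nat.le_mul_of_pos_right _ (hfpos G)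
    _ ≤ n := h

end Ultrametric

section Cover

variable {R : Type*} [CommRing R]

/-- **Small sumset cover for cross-witnessed (non-resonant) 2×2 depths.**  Let `u_1, …, u_n` be
ARBITRARY power series, `o : Fin n → ℕ` weights, and let each of `m` targets have exponent
`D_i = o_{a_i} + o_{b_i} + γ_i` with balanced weight `o_{a_i} + o_{b_i} = o_{c_i} + o_{d_i}` and a cross
witness `ord(u_{a_i} − u_{c_i}) = γ_i` of its depth.  Then `D ⊆ U + U` for some `U ⊂ ℕ` with
`|U| ≤ n (log₂ n + 1)`.  (Conclusion of `stub_swallowedInSmallSumset` for 2×2-initiated targets whose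
depth is non-resonant; heavy–light attribution on the `t`-adic ultrametric of the sources.) [folklore] -/
theorem exists_small_cover_of_crossDepth {n m : ℕ} (u : Fin n → R⟦X⟧) (o : Fin n → ℕ)
    (a b c d : Fin m → Fin n) (D γ : Fin m → ℕ)
    (hD : ∀ i, D i = o (a i) + o (b i) + γ i)
    (hw : ∀ i, o (a i) + o (b i) = o (c i) + o (d i))
    (hγ : ∀ i, (u (a i) - u (c i)).order = γ i) :
    ∃ U : Finset ℕ, U.card ≤ n * (Nat.log 2 n + 1) ∧ ∀ i, ∃ p ∈ U, ∃ q ∈ U, D i = p + q := by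
  classical
  -- a bound on the depths
  set G : ℕ := (univ.image γ).sup id + 1 with hG
  have hγG : ∀ i, γ i < G := by
    intro i
    have : γ i ≤ (univ.image γ).sup id := le_sup (f := id) (mem_image_of_mem γ (mem_univ i))
    omega
  -- light radii of a source
  set L : Fin n → Finset ℕ := fun x => (range G).filter fun g =>
    2 * (univ.filter fun y => ((g + 1 : ℕ) : ℕ∞) ≤ (u x - u y).order).card ≤
      (univ.filter fun y => (g : ℕ∞) ≤ (u x - u y).order).card with hL
  have hLcard : ∀ x, (L x).card ≤ Nat.log 2 n := by
    intro x
    exact Nat.le_log_of_pow_le (by norm_num) (two_pow_card_light_le u x G)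
  -- the cover
  set U : Finset ℕ := univ.image o ∪ univ.biUnion fun x => (L x).image fun g => o x + g with hU
  refine ⟨U, ?_, ?_⟩
  · -- size
    calc U.card ≤ (univ.image o).card + (univ.biUnion fun x => (L x).image fun g => o x + g).card :=
          card_union_le _ _
      _ ≤ n + ∑ x : Fin n, ((L x).image fun g => o x + g).card := by
          gcongr
          · exact le_trans card_image_le (by simp)
          · exact card_biUnion_le
      _ ≤ n + ∑ _x : Fin n, Nat.log 2 n := by
          gcongr with x
          exact le_trans card_image_le (hLcard x)
      _ = n * (Nat.log 2 n + 1) := by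
          rw [sum_const, card_univ, Fintype.card_fin, smul_eq_mul]; ring
  · -- cover
    intro i
    have hmemO : ∀ x, o x ∈ U := fun x =>
      mem_union_left _ (mem_image_of_mem o (mem_univ x))
    have hmemL : ∀ x g, g ∈ L x → o x + g ∈ U := fun x g hg =>
      mem_union_right _ (mem_biUnion.2 ⟨x, mem_univ x, mem_image_of_mem _ hg⟩)
    rcases light_or_light u (a i) (c i) (γ i) (hγ i) with hlight | hlight
    · -- attribute the depth to `a i`
      have hg : γ i ∈ L (a i) := by
        rw [hL]; exact mem_filter.2 ⟨mem_range.2 (hγG i), hlight⟩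
      exact ⟨o (a i) + γ i, hmemL _ _ hg, o (b i), hmemO _, by rw [hD i]; ring⟩
    · -- attribute the depth to `c i`, using the balanced weight
      have hg : γ i ∈ L (c i) := by
        rw [hL]; exact mem_filter.2 ⟨mem_range.2 (hγG i), hlight⟩
      exact ⟨o (c i) + γ i, hmemL _ _ hg, o (d i), hmemO _, by rw [hD i, hw i]; ring⟩

end Cover

/-- **Registered helper stub `helper_nonResonantCover`** (crux stmt-ValiantsHypothesis-6534, line
`registered`): `exists_small_cover_of_crossDepth` over `ℂ`, spelled out with all binders — born exponents
`D_i = o_{a_i} + o_{b_i} + γ_i` over balanced weights whose depth has a cross witness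
`ord(u_{a_i} − u_{c_i}) = γ_i` lie in `U + U` with `|U| ≤ n (log₂ n + 1)`. [folklore] -/
theorem helper_nonResonantCover : ∀ (n m : ℕ) (u : Fin n → PowerSeries ℂ) (o : Fin n → ℕ) (a b c d : Fin m → Fin n) (D γ : Fin m → ℕ), (∀ i, D i = o (a i) + o (b i) + γ i) → (∀ i, o (a i) + o (b i) = o (c i) + o (d i)) → (∀ i, (u (a i) - u (c i)).order = (γ i : ℕ∞)) → ∃ U : Finset ℕ, U.card ≤ n * (Nat.log 2 n + 1) ∧ ∀ i, ∃ p ∈ U, ∃ q ∈ U, D i = p + q :=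
  fun _ _ u o a b c d D γ hD hw hγ => exists_small_cover_of_crossDepth u o a b c d D γ hD hw hγ

end Summit.ValiantsHypothesis.ValiantsHypothesis.Theorems
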